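import Literature.NumberTheory.EllipticCurves.ZpExtensionEisensteinTwistToTwistModP
import Literature.NumberTheory.EllipticCurves.LambdaAdicSelmerDataToEisensteinH1Linear
import Literature.NumberTheory.EllipticCurves.IwasawaAlgebraEisensteinRankOneCokernelProofs
import HarnessLib

/-!
# A non-zero mod-`p` component of `s ∈ 𝔖_p(K_∞)` keeps the control image `f_m(s) ∈ H¹(K, T_𝔮)` out of
# `T^{p^{n₁}} · H¹(K, T_𝔮)` for EVERY `m ≥ p^{n₁}` (assembly of the rank-one route to the m-uniform cokernel bound
# of Howard's control map; proofs file)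

Topic `NumberTheory/EllipticCurves`. THEOREMS ONLY (no definition, no named fact, no instance, no `sorry`), in the pinned
currency of `WeierstrassCurve.LambdaAdicSelmerData` (`𝔖`), `ZpExtension.EisensteinH1Data` (`H = H¹(K, T_𝔮)`, `𝔮 = (T^m + p)`,
sign convention `κ⁻ = κ.unitTwist (-1)`) and `LambdaAdicSelmerData.toEisensteinH1Linear` (Howard's compact control map
`f : 𝔖 → H`, D1 lineage of the cell `pub/bsd-print-x9`).

WHAT. `toEisensteinH1Linear_not_mem_X_pow_smul_top`: if `p^{n₁} ≤ m` and the level-`(n₁, 1)` component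
`(proj n₁ s) 1 ∈ H¹(K_{n₁}, E[p])` of `s ∈ 𝔖` is non-zero, then `f s ∉ T^{p^{n₁}} • H`. Proof: `θ := H¹(Ξ) ∘ proj₁` with the
equivariant coefficient extraction `Ξ : E[p] ⊗ A_{m,1}(ψ) → 𝒯_{p^{n₁}}` (`ZpExtension.eisensteinToTwistModP`, p655289) kills
`T^{p^{n₁}} • H` (`map_eisensteinToTwistModP_map_smul_X_pow`, `EisensteinH1Data.proj_smul`) and sends `f s` to
`coresShapiro⁻ n₁ (cor_{Γ_n → Γ_{n₁}} (proj n s) 1) = coresShapiro⁻ n₁ ((proj n₁ s) 1)` (`proj_toEisensteinH1Linear`,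
`eisensteinComponent_apply`, `map_eisensteinToTwistModP_coresEisenstein_eq_coresShapiro`, `coresLe_proj_eq_proj`), which is
non-zero by the Shapiro bijection (`coresShapiro_eq_zero_iff`); then `IwasawaAlgebra.not_mem_X_pow_smul_top_of_map_ne_zero`
(p653099).

WHY (cell `pub/bsd-print-x9`, S1 = STUB 3 of the shared μ-item `MuInequalityCoherentPair`, COMPACT side; crux
`PrintX10b.BeyondCarrierDepthX10b`; memo `HOME/x10b-p1-w2/S1-COKERNEL-BLUEPRINT-x10b-p1-w2-g8.md`): restricted to the Selmer
parts, this is the hypothesis `he : f e ∉ T^{j₀} • H_m` of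
`IwasawaAlgebra.finite_quotient_range_and_natCard_le_of_not_mem_X_pow_smul` (p653099), giving
`Finite (H_m ⧸ range f) ∧ Nat.card (H_m ⧸ range f) ≤ p^{p^{n₁}}` for every `m > p^{n₁}` — the fields
`SpecWitness.finite_coker/card_coker_le` of `nonempty_specWitness_of_dvrConclusion` (p643969) with a constant UNIFORM in
`m`; the element `s ∉ p𝔖` with a non-zero mod-`p` component comes from Nakayama and
`PrintX10bModPDivision.exists_proj_one_ne_zero_of_not_mem` (p654361). No Poitou–Tate duality and no local index is used.
HONEST FRAMING: nothing about `L`-functions or Selmer ranks is asserted; no summit statement is proved; BSD is not proved by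
any of this.

References: [Howard2004HeegnerKolyvagin] B. Howard, Compositio Math. 140 (2004), §2.2, Lemma 2.2.7 / Prop. 2.2.8, proof of
Thm. 2.2.10 (𝔮 = T^m + p); [MazurRubinMemoirs2004] Prop. 5.3.14; [SerreGaloisCohomology1997] I §2.5 (Shapiro);
[PerrinRiou1987BSMF] §0 p. 402.
-/

set_option autoImplicit false

noncomputable section

open scoped TensorProduct Topology ContRepresentation
open Field CategoryTheory

universe u

/-! ## The assembly -/

namespace WeierstrassCurve.LambdaAdicSelmerData

open scoped Classical
open Literature.NumberTheory.EllipticCurves Literature.NumberTheory.GaloisRepresentations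
open Literature.NumberTheory.EllipticCurves.ZpExtension (eisensteinLevel)

variable {K : Type u} [Field K] [NumberField K] {V : WeierstrassCurve K} [V.IsElliptic] {p : ℕ} [hp : Fact p.Prime]
  {κ : ZpExtension K p} {γ : absoluteGaloisGroup K} (D : V.LambdaAdicSelmerData κ γ) {m : ℕ} (hm : 1 ≤ m)
  (t : ∀ k, (V.torsionGaloisModule ((p : ℤ) ^ (k + 1))).toContRepresentation →ⁱL
    (V.torsionGaloisModule ((p : ℤ) ^ k)).toContRepresentation)
  (ht : ∀ k (P : geomTorsion V ((p : ℤ) ^ (k + 1))), t k P = V.geomTorsionReduce p k P)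
  (I : ZpExtension.EisensteinH1Data (κ.unitTwist (-1)) (fun k ↦ V.torsionGaloisModule ((p : ℤ) ^ k)) t hm)

omit [NumberField K] [V.IsElliptic] hp in
/-- `E[p]` is killed by `p`. [folklore] -/
private theorem nsmul_geomTorsion_one_eq_zero (x : geomTorsion V ((p : ℤ) ^ 1)) : p • x = 0 :=
  Subtype.ext (by
    rw [AddSubmonoidClass.coe_nsmul, ZeroMemClass.coe_zero, ← natCast_zsmul]
    exact (congrArg (· • (x : geomPoints V)) (pow_one (p : ℤ))).symm.trans ((mem_geomTorsion_iff V _ _).1 x.2))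

/-- **A non-zero mod-`p` component keeps the control image out of `T^{p^{n₁}} • H_m`.** For the pinned compact control
map `f = toEisensteinH1Linear : 𝔖 → H = H¹(K, T_𝔮)` (`𝔮 = q_m`, sign convention `κ⁻`), `p^{n₁} ≤ m`, and `s ∈ 𝔖` whose
level-`(n₁, 1)` component `(proj n₁ s) 1 ∈ H¹(K_{n₁}, E[p])` is non-zero: `f s ∉ T^{p^{n₁}} • H`. Proof: `θ = H¹(Ξ) ∘ proj₁`
kills `T^{p^{n₁}} • H` (`map_eisensteinToTwistModP_map_smul_X_pow`) and `θ (f s) = coresShapiro⁻ n₁ ((proj n₁ s) 1) ≠ 0`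
(`map_eisensteinToTwistModP_coresEisenstein_eq_coresShapiro`, `coresLe_proj_eq_proj`, `coresShapiro_eq_zero_iff`).
With `IwasawaAlgebra.finite_quotient_range_and_natCard_le_of_not_mem_X_pow_smul` this gives `#(H_m ⧸ range f) ≤ p^{p^{n₁}}`
for every `m > p^{n₁}` on the Selmer part. [cite: Howard2004HeegnerKolyvagin, §2.2, Prop. 2.2.8 and proof of Thm. 2.2.10 (𝔮 = T^m + p)]
[cite: SerreGaloisCohomology1997, I §2.5 Prop. 10] -/
theorem toEisensteinH1Linear_not_mem_X_pow_smul_top (hγ : κ.IsTopGenerator γ)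
    (hE : ∀ P : V.toAffine.Point, p • P = 0 → P = 0) {n₁ : ℕ} (hn : p ^ n₁ ≤ m) (s : D.S)
    (hs : D.proj n₁ s 1 ≠ 0) :
    D.toEisensteinH1Linear hm t ht I hγ hE s ∉
      (Ideal.span {(PowerSeries.X : IwasawaAlgebra p) ^ (p ^ n₁)} • ⊤ : Submodule (IwasawaAlgebra p) I.H) := by
  haveI : CompactSpace (absoluteGaloisGroup K) := absoluteGaloisGroup_compactSpace K
  have hM1 : ∀ x : geomTorsion V ((p : ℤ) ^ 1), p • x = 0 := nsmul_geomTorsion_one_eq_zero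
  refine IwasawaAlgebra.not_mem_X_pow_smul_top_of_map_ne_zero p
    ((galoisCohomology.map ((κ.unitTwist (-1)).eisensteinToTwistModP (V.torsionGaloisModule ((p : ℤ) ^ 1)) hM1 hm n₁ hn)
      1).comp (I.proj 1)) (fun h ↦ ?_) ?_
  · rw [AddMonoidHom.comp_apply, I.proj_smul]
    exact ZpExtension.map_eisensteinToTwistModP_map_smul_X_pow _ _ hM1 hm n₁ hn le_rfl _
  · -- an auxiliary layer above both `J(m,1)` and `n₁`
    set n := max (eisensteinLevel (p := p) hm 1) n₁ + 1 with hn_def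
    have hn1 : eisensteinLevel (p := p) hm 1 ≤ n := (le_max_left _ _).trans (Nat.le_succ _)
    have hn2 : n₁ < n := Nat.lt_succ_of_le (le_max_right _ _)
    have hfin : ∀ j : ℕ, (κ.layerSubgroup j).FiniteIndex := fun j ↦
      ⟨by rw [κ.index_layerSubgroup j]; exact pow_ne_zero _ hp.out.ne_zero⟩
    have hfin' : ∀ j : ℕ, ((κ.unitTwist (-1)).layerSubgroup j).FiniteIndex := fun j ↦
      ⟨by rw [(κ.unitTwist (-1)).index_layerSubgroup j]; exact pow_ne_zero _ hp.out.ne_zero⟩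
    haveI := hfin
    haveI := hfin'
    haveI := κ.fintypeQuotientLayer n
    haveI := (κ.unitTwist (-1)).fintypeQuotientLayer n₁
    have hNn : κ.layerSubgroup n ≤ (κ.unitTwist (-1)).layerSubgroup n₁ := by
      rw [ZpExtension.layerSubgroup_unitTwist]; exact κ.layerSubgroup_antitone hn2.le
    haveI : Fintype ((κ.unitTwist (-1)).layerSubgroup n₁ ⧸ (κ.layerSubgroup n).subgroupOf ((κ.unitTwist (-1)).layerSubgroup n₁)) :=
      Fintype.ofFinite _
    haveI : Fintype (κ.layerSubgroup n₁ ⧸ (κ.layerSubgroup n).subgroupOf (κ.layerSubgroup n₁)) := Fintype.ofFinite _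
    rw [AddMonoidHom.comp_apply, D.proj_toEisensteinH1Linear hm t ht I hγ hE s 1 hn1,
      D.eisensteinComponent_apply hm 1 n hn1 s,
      ZpExtension.map_eisensteinToTwistModP_coresEisenstein_eq_coresShapiro _ _ hM1 hm n₁ hn (κ.layerSubgroup n) _ hNn _,
      Ne, ZpExtension.coresShapiro_eq_zero_iff]
    -- transport the target layer `Γ⁻_{n₁} = Γ_{n₁}` (equal subgroups, `layerSubgroup_unitTwist`) and use `cor (proj n) = proj n₁`
    have key : ∀ (H'' : Subgroup (absoluteGaloisGroup K)) (e : κ.layerSubgroup n₁ = H'') (h'' : κ.layerSubgroup n ≤ H'')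
        [Fintype (H'' ⧸ (κ.layerSubgroup n).subgroupOf H'')],
        coresLe (V.torsionGaloisModule ((p : ℤ) ^ 1)).toTopRep h'' (κ.isOpen_layerSubgroup n) (D.proj n s 1) = 0 →
          D.proj n₁ s 1 = 0 := by
      intro H'' e
      subst e
      intro h'' _ h0
      exact (D.coresLe_proj_eq_proj hγ hE 1 hn2 s).symm.trans h0
    exact fun h0 ↦ hs (key _ (κ.layerSubgroup_unitTwist (-1) n₁).symm hNn h0)

end WeierstrassCurve.LambdaAdicSelmerData

end
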